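import Literature.Barriers.QuantumAdvantage.TensorNetworkContractionGraph
import Literature.Computability.QuantumComplexity.RegisterPathSum
import Literature.LinearAlgebra.TensorNetworks.Basic
import HarnessLib

/-!
# Barrier catalogue `QuantumAdvantage` — the segment tensor network of a circuit and Markov–Shi's Prop. 3.5

Companion to `TensorNetworkContraction.lean` (the Markov–Shi barrier),
`TensorNetworkContractionGraph.lean` (the circuit graph `G_C`) and
`Literature/Computability/QuantumComplexity/RegisterPathSum.lean` (Born weights as double
register path sums). Markov–Shi, Prop. 3.5: "Let `C` be a quantum circuit, `x` a binary string,
and `τ` a measurement scenario. Contracting the tensor network `N(C; x, τ)` to a single vertex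
gives the rank-`0` tensor which is the probability that `τ` is realized on `C(ρ_x)`." Here
`N(C; x, τ)` is typed for Q2's circuits (unitary placed gates and oracle gates, input a basis
state `|z₀⟩`, `τ` a product of diagonal one-wire effects `obs w`, e.g. "wire `0` reads `1`"):

* the **indices** are the wire segments (the edges of `G_C`, with their multiplicity): a segment
  of wire `w` is named by the time boundary at which it starts, `Seg C = {(w, t) | canon C w t = t}`
  where `canon C w t` is the last boundary `≤ t` at which a gate acted on `w` (or `0`); each
  index ranges over `Bool × Bool` (Markov–Shi's `Π = {|b₁⟩⟨b₂|}`: a ket bit and a bra bit);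
* the **tensors** are the vertices of `G_C` (`CircuitNode`): the input vertex of `w` carries
  `|z₀ w⟩⟨z₀ w|`, the gate vertex `t` carries the superoperator `ρ ↦ U_t ρ U_t†` (entries
  `(U_t)_{out,in} · conj (U_t)_{out',in'}` read off the segments of its wires before and after
  it), the output vertex of `w` carries the effect `obs w` (trace against a diagonal operator);
* `segmentNetwork C A z₀ obs : TensorNetwork ℂ (Seg C) (Bool × Bool) (CircuitNode T N)` and
  **`value_segmentNetwork`**: its value (full contraction) is the Born weight
  `bornSum A C.gates z₀ obs = Σ_y obs(y) |⟨y|U_C|z₀⟩|²`; in particular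
  **`acceptProb_eq_value_segmentNetwork`**: Q2's acceptance probability is the value of the
  network with the indicator effect on wire `0` — Prop. 3.5 for the event "wire `0` reads `1`".

Proof (the source's "sequentially contracting input wires of `g_1, ⋯, g_t` gives the tensor
for `ρ^t`", made global): the double register path sum of `bornSum_eq_sum_regPathWeight` is
supported on pairs of paths that are idle-constant (a path changing a wire on which the current
gate does not act has weight `0`, `placeGate` being the identity there), idle-constant path
pairs are exactly the images `expand b` of the assignments `b` of ket/bra bits to segments, and
on them the summand is the product of the network's entries.

## References

* [MarkovShi2008] I. L. Markov, Y. Shi, SIAM J. Comput. 38 (2008) 963–981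
  (arXiv:quant-ph/0511069), §3: Def. 3.2 (tensor of a density operator / superoperator),
  Def. 3.4 (measurement scenario), the network `N(C; x, τ)`, Prop. 3.5 and its proof (p. 8).
  Read via `lit read paper:arxiv-quant-ph_0511069`.
-/

noncomputable section

namespace Literature.Barriers.QuantumAdvantage

open Literature.Computability.Cryptography Literature.Computability.QuantumComplexity
  Literature.LinearAlgebra.TensorNetworks

variable {G : QGateSet} {N : ℕ}

/-! ### Segments: canonical start boundaries -/

/-- `canon C w t`: the last time boundary `s ≤ t` at which a segment of wire `w` starts — `0`,
or `s` such that the gate `s - 1` acts on `w` — i.e. the start of the segment of `w` alive at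
boundary `t` (boundary `t` = after the first `t` gates; boundaries `> T` are never used and
inherit the value at `T`). [cite: MarkovShi2008, §3 (the network N(C))] -/
def canon (C : QCircuit G N) (w : Fin N) : ℕ → ℕ
  | 0 => 0
  | t + 1 =>
    if h : t < C.gates.length then (if w ∈ (C.gates[t]).wires then t + 1 else canon C w t)
    else canon C w t

/-- `canon C w 0 = 0`. [folklore] -/
@[simp] theorem canon_zero (C : QCircuit G N) (w : Fin N) : canon C w 0 = 0 := rfl

/-- A gate acting on `w` starts a new segment of `w`. [folklore] -/
theorem canon_succ_of_mem {C : QCircuit G N} {w : Fin N} {t : ℕ} (ht : t < C.gates.length)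
    (hw : w ∈ (C.gates[t]).wires) : canon C w (t + 1) = t + 1 := by
  simp [canon, ht, hw]

/-- A gate not acting on `w` does not interrupt the segment of `w`. [folklore] -/
theorem canon_succ_of_not_mem {C : QCircuit G N} {w : Fin N} {t : ℕ} (ht : t < C.gates.length)
    (hw : w ∉ (C.gates[t]).wires) : canon C w (t + 1) = canon C w t := by
  simp [canon, ht, hw]

/-- `canon C w t ≤ t`. [folklore] -/
theorem canon_le (C : QCircuit G N) (w : Fin N) : ∀ t, canon C w t ≤ t
  | 0 => le_rfl
  | t + 1 => by
    unfold canon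
    split_ifs <;> first | exact le_rfl | exact (canon_le C w t).trans (Nat.le_succ t)

/-- `canon` is idempotent: the start of a segment is its own start. [folklore] -/
theorem canon_canon (C : QCircuit G N) (w : Fin N) : ∀ t, canon C w (canon C w t) = canon C w t
  | 0 => rfl
  | t + 1 => by
    by_cases ht : t < C.gates.length
    · by_cases hw : w ∈ (C.gates[t]).wires
      · rw [canon_succ_of_mem ht hw, canon_succ_of_mem ht hw]
      · rw [canon_succ_of_not_mem ht hw, canon_canon C w t]
    · rw [show canon C w (t + 1) = canon C w t by simp [canon, ht], canon_canon C w t]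

/-- **The segments of a circuit** (the indices of its tensor network = the wire segments = the
edges of the circuit graph, with multiplicity): pairs (wire, starting boundary).
[cite: MarkovShi2008, §3 (the network N(C): "the qubit lines are wires connecting the tensors")] -/
def Seg (C : QCircuit G N) : Type :=
  {p : Fin N × Fin (C.gates.length + 1) // canon C p.1 p.2 = p.2}

/-- Segments form a finite type (a subtype of `Fin N × Fin (T+1)`). [folklore] -/
instance (C : QCircuit G N) : Fintype (Seg C) := by unfold Seg; infer_instance
/-- Equality of segments is decidable. [folklore] -/
instance (C : QCircuit G N) : DecidableEq (Seg C) := by unfold Seg; infer_instance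

/-- The segment of wire `w` alive at boundary `t`. [cite: MarkovShi2008, §3 (the network N(C))] -/
def segAt (C : QCircuit G N) (w : Fin N) (t : Fin (C.gates.length + 1)) : Seg C :=
  ⟨(w, ⟨canon C w t, lt_of_le_of_lt (canon_le C w t) t.isLt⟩), by
    simp [canon_canon]⟩

/-- A segment is the segment alive at its own start. [folklore] -/
theorem segAt_self {C : QCircuit G N} (s : Seg C) : segAt C s.1.1 s.1.2 = s := by
  obtain ⟨⟨w, t⟩, hs⟩ := s
  exact Subtype.ext (Prod.ext rfl (Fin.ext hs))

/-- Consecutive boundaries on an idle wire carry the same segment. [folklore] -/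
theorem segAt_succ_of_not_mem {C : QCircuit G N} {w : Fin N} (t : Fin C.gates.length)
    (hw : w ∉ (C.gates[(t : ℕ)]).wires) : segAt C w t.succ = segAt C w t.castSucc := by
  refine Subtype.ext (Prod.ext rfl (Fin.ext ?_))
  simp [segAt, canon_succ_of_not_mem t.isLt hw]

/-- The register states (ket and bra copies) at boundary `t` read off an assignment of the
segments. [cite: MarkovShi2008, §3 (proof of Prop 3.5: the tensor for ρ^t)] -/
def ketAt {C : QCircuit G N} (b : Seg C → Bool × Bool) (t : Fin (C.gates.length + 1)) : QReg N :=
  fun w => (b (segAt C w t)).1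

/-- The bra copy of the register state at boundary `t` read off an assignment of the segments.
[cite: MarkovShi2008, §3 (proof of Prop 3.5: the tensor for ρ^t)] -/
def braAt {C : QCircuit G N} (b : Seg C → Bool × Bool) (t : Fin (C.gates.length + 1)) : QReg N :=
  fun w => (b (segAt C w t)).2

/-! ### Entries of placed gates -/

/-- A placed gate (or oracle query) acts as the identity off its wires: an entry whose row and
column states differ on a wire outside the gate vanishes. Deliberate dot-notation extension of
Q2's `QGate` (another directory). [folklore] -/
theorem _root_.Literature.Computability.Cryptography.QGate.toMatrix_apply_eq_zero_of_apply_ne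
    {g : QGate G N} (A : Language Bool) {x y : QReg N} {w : Fin N} (hw : w ∉ g.wires)
    (hne : x w ≠ y w) : g.toMatrix A x y = 0 := by
  cases g with
  | gate op e =>
    rw [QGate.toMatrix_gate, placeGate_apply, if_neg]
    intro h
    refine hne (h w fun ⟨i, hi⟩ => hw ?_)
    simp only [QGate.wires, Finset.mem_map, Finset.mem_univ, true_and]
    exact ⟨i, hi⟩
  | oracle k e =>
    rw [QGate.toMatrix_oracle, placeGate_apply, if_neg]
    intro h
    refine hne (h w fun ⟨i, hi⟩ => hw ?_)
    simp only [QGate.wires, Finset.mem_map, Finset.mem_univ, true_and]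
    exact ⟨i, hi⟩

/-- An entry of a placed gate whose row and column states agree off the gate depends only on
their restrictions to the gate's wires. Deliberate dot-notation extension of Q2's `QGate`.
[folklore] -/
theorem _root_.Literature.Computability.Cryptography.QGate.toMatrix_apply_congr_wires
    {g : QGate G N} (A : Language Bool) {x y x' y' : QReg N}
    (hx : ∀ w ∈ g.wires, x w = x' w) (hy : ∀ w ∈ g.wires, y w = y' w)
    (hxy : ∀ w ∉ g.wires, x w = y w) (hxy' : ∀ w ∉ g.wires, x' w = y' w) :
    g.toMatrix A x y = g.toMatrix A x' y' := by
  have key : ∀ {k : ℕ} (e : Fin k ↪ Fin N) (M : Matrix (QReg k) (QReg k) ℂ),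
      g.wires = Finset.univ.map e → placeGate e M x y = placeGate e M x' y' := by
    intro k e M hwires
    have hr : ∀ w, w ∉ Set.range e → w ∉ g.wires := fun w hw hw' => hw (by
      rw [hwires, Finset.mem_map] at hw'
      obtain ⟨i, -, hi⟩ := hw'
      exact ⟨i, hi⟩)
    have hin : ∀ i, e i ∈ g.wires := fun i => by
      rw [hwires]; exact Finset.mem_map_of_mem _ (Finset.mem_univ _)
    rw [placeGate_apply, placeGate_apply, if_pos fun w hw => hxy w (hr w hw),
      if_pos fun w hw => hxy' w (hr w hw)]
    congr 1 <;> funext i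
    · exact hx (e i) (hin i)
    · exact hy (e i) (hin i)
  cases g with
  | gate op e => exact key e _ rfl
  | oracle k e => exact key e _ rfl

/-! ### The segment network `N(C; z₀, obs)` -/

/-- **The segment tensor network of a circuit** (Markov–Shi's `N(C; x, τ)` for Q2's circuits):
indices = segments (`Seg C`) ranging over `Bool × Bool` (ket bit, bra bit); tensors = the
vertices of the circuit graph: the input vertex of wire `w` is the tensor of `|z₀ w⟩⟨z₀ w|`
(scope: the first segment of `w`), the gate vertex `t` is the tensor of the superoperator
`ρ ↦ U_t ρ U_t†`, entries `(U_t)_{out,in} · conj (U_t)_{out',in'}` (scope: the segments of its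
wires alive before and after it), the output vertex of `w` is the diagonal effect `obs w`
(scope: the last segment of `w`; `obs w = 1` traces the wire out, `obs w = [· = true]`
post-selects it). [cite: MarkovShi2008, §3 (Def 3.2, Def 3.4, the network N(C; x, τ))] -/
def segmentNetwork (C : QCircuit G N) (A : Language Bool) (z₀ : QReg N)
    (obs : Fin N → Bool → ℂ) :
    TensorNetwork ℂ (Seg C) (Bool × Bool) (CircuitNode C.gates.length N) where
  scope
    | .input w => {segAt C w 0}
    | .gate t => (C.gates[(t : ℕ)]).wires.biUnion fun w => {segAt C w t.castSucc, segAt C w t.succ}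
    | .output w => {segAt C w (Fin.last _)}
  entry
    | .input w => fun b => if b (segAt C w 0) = (z₀ w, z₀ w) then 1 else 0
    | .gate t => fun b =>
        (C.gates[(t : ℕ)]).toMatrix A (ketAt b t.succ) (ketAt b t.castSucc) *
          (starRingEnd ℂ) ((C.gates[(t : ℕ)]).toMatrix A (braAt b t.succ) (braAt b t.castSucc))
    | .output w => fun b =>
        if (b (segAt C w (Fin.last _))).1 = (b (segAt C w (Fin.last _))).2 then
          obs w (b (segAt C w (Fin.last _))).1 else 0
  entry_congr := by
    rintro (w | t | w) a b hab
    · have h := hab (segAt C w 0) (Finset.mem_singleton_self _)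
      simp only [h]
    · have hmem : ∀ w ∈ (C.gates[(t : ℕ)]).wires,
          a (segAt C w t.castSucc) = b (segAt C w t.castSucc) ∧
            a (segAt C w t.succ) = b (segAt C w t.succ) := fun w hw =>
        ⟨hab _ (Finset.mem_biUnion.2 ⟨w, hw, by simp⟩),
          hab _ (Finset.mem_biUnion.2 ⟨w, hw, by simp⟩)⟩
      have hidle : ∀ (c : Seg C → Bool × Bool), ∀ w ∉ (C.gates[(t : ℕ)]).wires,
          c (segAt C w t.succ) = c (segAt C w t.castSucc) := fun c w hw => by
        rw [segAt_succ_of_not_mem t hw]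
      simp only
      congr 1
      · exact QGate.toMatrix_apply_congr_wires A (fun w hw => congrArg Prod.fst (hmem w hw).2)
          (fun w hw => congrArg Prod.fst (hmem w hw).1)
          (fun w hw => congrArg Prod.fst (hidle a w hw)) (fun w hw => congrArg Prod.fst (hidle b w hw))
      · exact congrArg _ (QGate.toMatrix_apply_congr_wires A
          (fun w hw => congrArg Prod.snd (hmem w hw).2) (fun w hw => congrArg Prod.snd (hmem w hw).1)
          (fun w hw => congrArg Prod.snd (hidle a w hw)) (fun w hw => congrArg Prod.snd (hidle b w hw)))
    · have h := hab (segAt C w (Fin.last _)) (Finset.mem_singleton_self _)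
      simp only [h]

/-! ### Idle-constant paths are read off segment assignments -/

/-- A register path is **idle-constant** if a wire changes only when a gate acts on it.
[folklore] -/
def IdleConstant (C : QCircuit G N) (π : Fin (C.gates.length + 1) → QReg N) : Prop :=
  ∀ (t : Fin C.gates.length), ∀ w ∉ (C.gates[(t : ℕ)]).wires, π t.succ w = π t.castSucc w

/-- A path of nonzero weight is idle-constant (gates are the identity off their wires).
[cite: MarkovShi2008, §3 (proof of Prop 3.5)] -/
theorem idleConstant_of_regPathWeight_ne_zero {C : QCircuit G N} (A : Language Bool)
    {π : Fin (C.gates.length + 1) → QReg N} (h : regPathWeight A C.gates π ≠ 0) :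
    IdleConstant C π := by
  intro t w hw
  by_contra hne
  refine h (Finset.prod_eq_zero (Finset.mem_univ t) ?_)
  exact QGate.toMatrix_apply_eq_zero_of_apply_ne A hw hne

/-- Along an idle-constant path the value of wire `w` at boundary `t` is its value at the start
`canon C w t` of the segment alive at `t`. [folklore] -/
theorem apply_canon_of_idleConstant {C : QCircuit G N} {π : Fin (C.gates.length + 1) → QReg N}
    (hπ : IdleConstant C π) (w : Fin N) :
    ∀ (n : ℕ) (hn : n < C.gates.length + 1),
      π ⟨canon C w n, lt_of_le_of_lt (canon_le C w n) hn⟩ w = π ⟨n, hn⟩ w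
  | 0, _ => rfl
  | n + 1, hn => by
    have hnT : n < C.gates.length := by omega
    by_cases hw : w ∈ (C.gates[n]).wires
    · have : (⟨canon C w (n + 1), lt_of_le_of_lt (canon_le C w (n + 1)) hn⟩ :
          Fin (C.gates.length + 1)) = ⟨n + 1, hn⟩ := Fin.ext (canon_succ_of_mem hnT hw)
      rw [this]
    · have h1 : (⟨canon C w (n + 1), lt_of_le_of_lt (canon_le C w (n + 1)) hn⟩ :
          Fin (C.gates.length + 1)) = ⟨canon C w n, lt_of_le_of_lt (canon_le C w n) (by omega)⟩ :=
        Fin.ext (canon_succ_of_not_mem hnT hw)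
      rw [h1, apply_canon_of_idleConstant hπ w n (by omega)]
      exact (hπ ⟨n, hnT⟩ w hw).symm

/-- `expand b`: the pair of register paths (ket, bra) read off an assignment of the segments.
[cite: MarkovShi2008, §3 (proof of Prop 3.5)] -/
def expand (C : QCircuit G N) (b : Seg C → Bool × Bool) :
    (Fin (C.gates.length + 1) → QReg N) × (Fin (C.gates.length + 1) → QReg N) :=
  (fun t => ketAt b t, fun t => braAt b t)

/-- `expand` is injective: a segment is read at its own start. [folklore] -/
theorem expand_injective (C : QCircuit G N) : Function.Injective (expand C) := fun b₁ b₂ h => by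
  funext s
  have h1 := congrFun (congrFun (congrArg Prod.fst h) s.1.2) s.1.1
  have h2 := congrFun (congrFun (congrArg Prod.snd h) s.1.2) s.1.1
  simp only [expand, ketAt, braAt, segAt_self] at h1 h2
  exact Prod.ext h1 h2

/-- An idle-constant pair of paths is read off the assignment "value of each segment at its
start". [folklore] -/
theorem exists_expand_eq {C : QCircuit G N} {π π' : Fin (C.gates.length + 1) → QReg N}
    (hπ : IdleConstant C π) (hπ' : IdleConstant C π') :
    ∃ b : Seg C → Bool × Bool, expand C b = (π, π') := by
  exact ⟨fun s => (π s.1.2 s.1.1, π' s.1.2 s.1.1), Prod.ext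
    (funext fun t => funext fun w => apply_canon_of_idleConstant hπ w t t.isLt)
    (funext fun t => funext fun w => apply_canon_of_idleConstant hπ' w t t.isLt)⟩

/-! ### The nodes of the circuit graph as a sum type (to split products) -/

/-- `CircuitNode T N ≃ (Fin N ⊕ Fin T) ⊕ Fin N` (inputs, gates, outputs). [folklore] -/
def circuitNodeEquivSum (T N : ℕ) : CircuitNode T N ≃ (Fin N ⊕ Fin T) ⊕ Fin N where
  toFun
    | .input w => Sum.inl (Sum.inl w)
    | .gate t => Sum.inl (Sum.inr t)
    | .output w => Sum.inr w
  invFun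
    | Sum.inl (Sum.inl w) => .input w
    | Sum.inl (Sum.inr t) => .gate t
    | Sum.inr w => .output w
  left_inv u := by cases u <;> rfl
  right_inv s := by rcases s with (w | t) | w <;> rfl

/-- Splitting a product over the nodes of the circuit graph. [folklore] -/
theorem prod_circuitNode {M : Type*} [CommMonoid M] {T : ℕ} (f : CircuitNode T N → M) :
    ∏ u, f u = ((∏ w : Fin N, f (.input w)) * ∏ t : Fin T, f (.gate t)) * ∏ w : Fin N, f (.output w) := by
  rw [← (circuitNodeEquivSum T N).symm.prod_comp, Fintype.prod_sum_type, Fintype.prod_sum_type]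
  rfl

/-! ### Prop 3.5: the value of the segment network is the Born weight -/

/-- **Markov–Shi 2008, Prop. 3.5** for Q2's circuits: the value (full contraction) of the segment
tensor network `N(C; z₀, obs)` is the Born weight `Σ_y obs(y) ⟨y|U_C|z₀⟩ conj ⟨y|U_C|z₀⟩`
(`bornSum`). Proof: the Born weight is the double register path sum
(`bornSum_eq_sum_regPathWeight`); its summand vanishes off the idle-constant pairs of paths
(`idleConstant_of_regPathWeight_ne_zero`), which are the images of segment assignments
(`exists_expand_eq`, `expand_injective`), and at `expand b` it is the product of the network's
entries. [cite: MarkovShi2008, §3 (Prop 3.5)] -/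
theorem value_segmentNetwork (C : QCircuit G N) (A : Language Bool) (z₀ : QReg N)
    (obs : Fin N → Bool → ℂ) :
    (segmentNetwork C A z₀ obs).value = bornSum A C.gates z₀ obs := by
  classical
  -- the summand of the double path sum, on pairs of paths
  set F : (Fin (C.gates.length + 1) → QReg N) × (Fin (C.gates.length + 1) → QReg N) → ℂ :=
    fun p => if p.1 0 = z₀ ∧ p.2 0 = z₀ ∧ p.1 (Fin.last _) = p.2 (Fin.last _) then
      obsWeight obs (p.1 (Fin.last _)) *
        (regPathWeight A C.gates p.1 * (starRingEnd ℂ) (regPathWeight A C.gates p.2)) else 0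
    with hF
  have hborn : bornSum A C.gates z₀ obs = ∑ p, F p := by
    rw [bornSum_eq_sum_regPathWeight, ← Fintype.sum_prod_type']
  -- (1) the summand vanishes off the image of `expand`
  have hsupp : ∀ p, F p ≠ 0 → p ∈ Finset.univ.image (expand C) := by
    rintro ⟨π, π'⟩ hp
    simp only [hF, ne_eq, ite_eq_right_iff, Classical.not_imp, mul_eq_zero, not_or] at hp
    obtain ⟨-, -, hw, hw'⟩ := hp
    have hw'' : regPathWeight A C.gates π' ≠ 0 := fun h => hw' (by rw [h, map_zero])
    obtain ⟨b, hb⟩ := exists_expand_eq (idleConstant_of_regPathWeight_ne_zero A hw)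
      (idleConstant_of_regPathWeight_ne_zero A hw'')
    exact Finset.mem_image.2 ⟨b, Finset.mem_univ _, hb⟩
  -- (2) at `expand b` the summand is the product of the entries
  have hentry : ∀ b : Seg C → Bool × Bool,
      ∏ u, (segmentNetwork C A z₀ obs).entry u b = F (expand C b) := by
    intro b
    rw [prod_circuitNode]
    -- inputs
    have hin : ∏ w : Fin N, (segmentNetwork C A z₀ obs).entry (.input w) b =
        if ketAt b 0 = z₀ ∧ braAt b 0 = z₀ then 1 else 0 := by
      simp only [segmentNetwork, Finset.prod_boole, Finset.mem_univ, true_implies]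
      congr 1
      simp only [funext_iff, ketAt, braAt, Prod.ext_iff, eq_iff_iff]
      exact ⟨fun h => ⟨fun w => (h w).1, fun w => (h w).2⟩, fun h w => ⟨h.1 w, h.2 w⟩⟩
    -- gates
    have hgate : ∏ t : Fin C.gates.length, (segmentNetwork C A z₀ obs).entry (.gate t) b =
        regPathWeight A C.gates (expand C b).1 *
          (starRingEnd ℂ) (regPathWeight A C.gates (expand C b).2) := by
      simp only [segmentNetwork, Finset.prod_mul_distrib, regPathWeight, map_prod]
      rfl
    -- outputs
    have hout : ∏ w : Fin N, (segmentNetwork C A z₀ obs).entry (.output w) b =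
        if ketAt b (Fin.last _) = braAt b (Fin.last _) then obsWeight obs (ketAt b (Fin.last _))
        else 0 := by
      simp only [segmentNetwork, Finset.prod_ite_zero, Finset.mem_univ, true_implies, obsWeight]
      congr 1
      simp only [funext_iff, ketAt, braAt]
    rw [hin, hgate, hout]
    simp only [hF, expand]
    by_cases h0 : ketAt b 0 = z₀ ∧ braAt b 0 = z₀
    · by_cases hT : ketAt b (Fin.last _) = braAt b (Fin.last _)
      · have hT' : (fun t => ketAt b t) (Fin.last _) = (fun t => braAt b t) (Fin.last _) := hT
        simp only [h0, hT', and_self, if_true, one_mul]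
        ring
      · simp [h0, (show ¬ (fun t => ketAt b t) (Fin.last _) = (fun t => braAt b t) (Fin.last _) from hT)]
    · have h0' : ¬ ((fun t => ketAt b t) 0 = z₀ ∧ (fun t => braAt b t) 0 = z₀ ∧
          (fun t => ketAt b t) (Fin.last _) = (fun t => braAt b t) (Fin.last _)) :=
        fun h => h0 ⟨h.1, h.2.1⟩
      rw [if_neg h0, if_neg h0']
      simp
  -- (3) assemble
  calc (segmentNetwork C A z₀ obs).value
      = ∑ b : Seg C → Bool × Bool, F (expand C b) := Finset.sum_congr rfl fun b _ => hentry b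
    _ = ∑ p ∈ Finset.univ.image (expand C), F p :=
        (Finset.sum_image fun b _ b' _ h => expand_injective C h).symm
    _ = ∑ p, F p := Finset.sum_subset (Finset.subset_univ _) fun p _ hp => by
        by_contra h
        exact hp (hsupp p h)
    _ = bornSum A C.gates z₀ obs := hborn.symm

/-- **Prop. 3.5 for the acceptance event**: the probability that wire `0` reads `1` when the
circuit `C` on `n + m` wires is run on `|x⟩|0^m⟩` (Q2's `acceptProb`) is the value of the segment
tensor network with input `|x 0^m⟩`, the indicator effect on wire `0` and all other wires traced
out. [cite: MarkovShi2008, §3 (Prop 3.5)] -/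
theorem acceptProb_eq_value_segmentNetwork {n m : ℕ} (A : Language Bool) (C : QCircuit G (n + m))
    (x : QReg n) (h : 0 < n + m) :
    (C.acceptProb A x : ℂ) =
      (segmentNetwork C A (padInput x m)
        (fun w b => if w = ⟨0, h⟩ then (if b then 1 else 0) else 1)).value := by
  rw [value_segmentNetwork, acceptProb_eq_bornSum]

end Literature.Barriers.QuantumAdvantage

end
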